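/- Copyright: the b2b-balaban cell (near-miss cell 7), T⁴-continuum fan-out; row NE7b ROUND-2 swarm, seat
t4-ne7b-formalise-leaf-06 (gen 5) (road W-RP, supplier «W3h» file 3: the level-0 RP-package at EVERY translate of the
centre cut, and the `j = 0` junction with W3f; INTENT journal l.15783; v1.1: + §4 the `(i, k)` family).  Released under the
licence of the surrounding project. -/
import Summits.QuantumFields.BalabanUV.T4Continuum.Support.HistoryRPGibbs
import Summits.QuantumFields.BalabanUV.T4Continuum.Support.HistoryRPAveraging
import Literature.MathematicalPhysics.QuantumFieldTheory.Balaban1983to89.T4UndoubledRP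

/-!
# Road W-RP, supplier «W3h» (file 3): the level-0 RP-package at every block-boundary cut; the junction with W3f at `j = 0`

Summits-side support leaf of the T⁴-continuum cell (rung (B)+1 on a FINITE torus only; NOT infinite volume, NOT the
mass gap, NOT the Clay statement; NOT a proof of the spine estimate NE7b).  Row NE7b, road **W-RP**, supplier «W3h»
(owner GO l.15301; files 1–2 `HistoryRPGibbsState` p222370 ∕ `HistoryRPGibbs` p222539).  [folklore] bookkeeping over
tree theorems consumed BY NAME: file 2's `rpPackage_gibbs_creflect` (centre cut), file 1's
`measurePreserving_gibbsMeasure_of_isExpectSymmetry` with `IsExpectSymmetry.translate` (`TorusLimitAxioms`), W3c's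
`HistoryRPBase.rpPackage_conj`, pv07's `T4UndoubledRP.{measurable_translate, gaugeField_reflect_translate, site_reflect_add}`,
W-CUTS (= sub-row W3g, leaf-02 g8) `HistoryRPAveragingCuts.toConfig_translate_creflect`, and W3f (leaf-04 g6)
`HistoryRPAveraging.{rpPackage_level_of_local_equivariant, isReflectionPositiveBdd_level_blockAvg}`.  No `def`, no
`structure`, no `[cite:]` tag, nothing printed asserted, no estimate of [B12]–[B16] used.

WHAT.
* §1 `creflect_conj_translate`: for a vector `a` reversed by the axis (`a.reflect ρ = −a`), the translation-conjugate of the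
  centre reflection is the centre reflection after the doubled translation, `τ_{−a} ∘ c_ρ ∘ τ_a = c_ρ ∘ τ_{2a}` (pull-backs);
  `nsmul_zero_shift_reflect` (`(n e_ρ).reflect ρ = −n e_ρ`); **`toConfig_conj_creflect`**: read through the dictionary,
  `U ↦ ((U ∘ τ_{n e_ρ}) c_ρ) ∘ τ_{−n e_ρ}` IS the road's `configReflect ρ (2n − 1)` — the block-boundary cut `n·1 − 1 ∣ n`
  (W3e's `(i, k)` family `2·k·b − 1` at `n = k·b`).
* §2 **`rpPackage_gibbs_cut`**: for `β ≥ 0`, an axis `ρ` and ANY lattice vector `a`, the five sentences for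
  `(gibbsMeasure P β, (mPos G 0 ρ).comap (τ_a), τ_{−a} ∘ c_ρ ∘ τ_a)` — file 2's centre-cut package transported along the
  exact symmetry `τ_a` (W3c's `rpPackage_conj`); `rpPackage_gibbs_cut_SU` hypothesis-free; the usable criterion
  `piFinset_le_mPos_comap_translate` (observables of the bonds `b` whose back-translate `b − a` is positive are measurable
  for the transported algebra).
* §3 THE JUNCTION WITH W3f AT `j = 0`: **`isReflectionPositiveBdd_level_blockAvg_gibbs`** — W3f's one-level theorem for
  Bałaban's (0.4)-typed averaging `blockAvg ℰ` with its two remaining base binders (`c_ρ`-invariance and `mPos`-reflection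
  positivity of the base state) DISCHARGED by files 1–2 for the cell's level-0 Gibbs state: «the δ-extended one-level
  state of the Wilson Gibbs measure under `blockAvg ℰ` is reflection positive at the centre cut of every axis»;
  `…_SU` for `SU(n)` (left: `1 ≤ m + K`, measurability of `ℰ.E`, `β ≥ 0`).
* §4 (v1.1, append-only) `rpPackage_gibbs_blocks` ∕ `isReflectionPositiveBdd_gibbs_blocks_SU` ∕ `toConfig_conj_creflect_block`:
  §2 at the vectors `(k.val·b) • e_i` — the five families in W4b′'s `CutoffReading` quantifier shape `∀ (i : Fin d)
  (k : ZMod Nc)` at cutoff zero, the reflections read as W3e's `configReflect i (2·k·b − 1)`.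

HONEST SCOPE (c4).  State side at LEVEL 0 only (the extended state's higher levels = W3b ∕ W3i); the typing identification
«`blockAvg ℰ` = (0.4)» is T-class as everywhere in the cell; nothing of (EXT)∕(LOC)-for-events∕(R-sym)∕(U1)∕(G2), nothing
of H3 ∕ (B) ∕ BetaPertH; no exit ∕ socket ∕ `HistoryConstants` ∕ END touched (c3), no `Prop` fact minted (c1), no constant
(c2∕c6).  NE7b NOT proved; spine 0∕9.  HONEST DEPENDENCY (cell): continuum YM on T⁴ ⇐ BetaPertH ∧ nine spine estimates
(0/9 proved); BetaPertH ⇐ (D1) ∧ (D4) ∧ CAP+tail; G-an2-4 gates asym, D1 and NE2/3/4.  This file changes none of it.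
-/

open MeasureTheory ProbabilityTheory
open Literature.MathematicalPhysics.QuantumFieldTheory
open Literature.MathematicalPhysics.QuantumFieldTheory.LatticeRP (IsReflectionPositiveBdd)
open Literature.MathematicalPhysics.QuantumFieldTheory.Balaban1983to89
open Summit.QuantumFields.YangMills.Theorems.ContinuumLegGivenGap (configReflect)
open Summit.QuantumFields.BalabanUV.T4Continuum.HistoryRPHalfTorus (posBonds crossBonds mPos mem_posBonds mPos_le
  creflect_comp_self measurable_creflect)
open Summit.QuantumFields.BalabanUV.T4Continuum.HistoryRPAveraging (posRead crossRead crossRefl measurable_posRead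
  measurable_crossRead)
open BlockAveraging T4ReflectionConeSharp

namespace Summit.QuantumFields.BalabanUV.T4Continuum.HistoryRPGibbsCuts

noncomputable section

/-! ## §1 Translation-conjugates of the centre reflection and their dictionary -/

section Conj

variable {P : Params} {j : ℕ} {G : Type*} [GaugeGroup G]

/-- **`τ_{−a} ∘ c_ρ ∘ τ_a = c_ρ ∘ τ_{2a}`** (pull-backs on fields) for a vector reversed by the axis, `a.reflect ρ = −a` — the
centre-reflection twin of pv07's `T4UndoubledRP.reflect_conj_translate`. [folklore] -/
theorem creflect_conj_translate (ρ : Fin P.d) (a : Site P j) (ha : a.reflect ρ = -a) (U : GaugeField P j G) :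
    ((U.translate a).creflect ρ).translate (-a) = (U.translate (a + a)).creflect ρ := by
  rw [GaugeField.creflect_eq, GaugeField.creflect_eq, GaugeField.translate_translate, GaugeField.translate_translate]
  have h := T4UndoubledRP.gaugeField_reflect_translate ρ a (U.translate ((0 : Site P j).unshift ρ + a))
  rw [ha, GaugeField.translate_translate] at h
  rw [← h]
  congr 2
  abel

/-- The vector `n e_ρ` is reversed by the axis reflection: `(n e_ρ).reflect ρ = −(n e_ρ)`. [folklore] -/
theorem nsmul_zero_shift_reflect (ρ : Fin P.d) (n : ℕ) :
    (n • (0 : Site P j).shift ρ).reflect ρ = -(n • (0 : Site P j).shift ρ) := by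
  funext κ
  rw [Site.reflect_apply]
  show (if κ = ρ then -((n • (0 : Site P j).shift ρ) ρ) else (n • (0 : Site P j).shift ρ) κ) =
    -((n • (0 : Site P j).shift ρ) κ)
  rw [HistoryRPAveragingCuts.nsmul_zero_shift_apply, HistoryRPAveragingCuts.nsmul_zero_shift_apply, if_pos rfl]
  by_cases h : κ = ρ
  · simp only [if_pos h]
  · simp only [if_neg h, neg_zero]

/-- **DICTIONARY**: the translation-conjugate `U ↦ ((U ∘ τ_{n e_ρ}) c_ρ) ∘ τ_{−n e_ρ}` of the centre reflection IS the road's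
wall reflection `configReflect ρ (2n − 1)` at the cut `n − 1 ∣ n` of `T^{(j)}` (W-CUTS `toConfig_translate_creflect` at
`2n`). [folklore] -/
theorem toConfig_conj_creflect (ρ : Fin P.d) (n : ℕ) (U : GaugeField P j G) :
    toConfig (((U.translate (n • (0 : Site P j).shift ρ)).creflect ρ).translate (-(n • (0 : Site P j).shift ρ))) =
      configReflect ρ ((((2 * n : ℕ)) : ZMod (P.sitesPerDir j)) - 1) (toConfig U) := by
  rw [creflect_conj_translate ρ _ (nsmul_zero_shift_reflect ρ n), ← HistoryRPAveragingCuts.toConfig_translate_creflect,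
    two_mul, add_nsmul]

end Conj

/-! ## §2 The level-0 package at the cut through any lattice vector -/

section Cut

variable {P : Params} {G : Type*}

/-- Translating forth and back is the identity (`τ_{a} ∘ τ_{−a} = id` as pull-backs). [folklore] -/
theorem translate_neg_translate (a : Site P 0) (U : GaugeField P 0 G) : (U.translate (-a)).translate a = U := by
  rw [GaugeField.translate_translate, add_neg_cancel, GaugeField.translate_zero]

/-- `τ_{−a} ∘ τ_{a} = id`. [folklore] -/
theorem translate_translate_neg (a : Site P 0) (U : GaugeField P 0 G) : (U.translate a).translate (-a) = U := by
  rw [GaugeField.translate_translate, neg_add_cancel, GaugeField.translate_zero]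

variable [GaugeGroup G] [MeasurableSpace G] [RegularGaugeGroup G] [HaarData G]

/-- The translations preserve the Gibbs state (`β ≥ 0`): exact symmetries (`IsExpectSymmetry.translate`) through file 1's
`measurePreserving_gibbsMeasure_of_isExpectSymmetry`. [folklore] -/
theorem map_translate_gibbsMeasure {β : ℝ} (hβ : 0 ≤ β) (a : Site P 0) :
    (T4GenFunBounds.gibbsMeasure (G := G) P β).map (GaugeField.translate a) = T4GenFunBounds.gibbsMeasure (G := G) P β :=
  (HistoryRPGibbsState.measurePreserving_gibbsMeasure_of_isExpectSymmetry hβ (T4UndoubledRP.measurable_translate a)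
    (Missing.IsExpectSymmetry.translate a)).map_eq

variable [TopologicalSpace G] [IsTopologicalGroup G] [CompactSpace G] [BorelSpace G] {N : ℕ}
  (ϱ : G →* Matrix (Fin N) (Fin N) ℂ)

/-- **THE LEVEL-0 RP-PACKAGE AT THE CUT THROUGH `a`**: for `β ≥ 0`, an axis `ρ`, ANY lattice vector `a` of `T^{(0)}`, and
`G` under the hypotheses of `TorusReflectionPositivity`, the five sentences for the Gibbs state, the transported positive
σ-algebra `(mPos G 0 ρ).comap τ_a` (observables of the positive half-torus SHIFTED to the far side of the cut through `a`)
and the conjugated reflection `τ_{−a} ∘ c_ρ ∘ τ_a` (for `a = n e_ρ`: the road's `configReflect ρ (2n − 1)`,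
`toConfig_conj_creflect`) — W3c's `rpPackage_conj` on file 2's `rpPackage_gibbs_creflect`. [folklore] -/
theorem rpPackage_gibbs_cut (hhaar : (HaarData.haar : Measure G) = haarProbability G) (hϱ : Continuous ϱ) (hN : N ≠ 0)
    (hre : ∀ g : G, reTr g * N = ((ϱ g).trace).re) {β : ℝ} (hβ : 0 ≤ β) (ρ : Fin P.d) (a : Site P 0) :
    (mPos G 0 ρ).comap (GaugeField.translate a) ≤ (inferInstance : MeasurableSpace (GaugeField P 0 G)) ∧
      Measurable (fun U : GaugeField P 0 G => ((U.translate a).creflect ρ).translate (-a)) ∧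
      MeasurePreserving (fun U : GaugeField P 0 G => ((U.translate a).creflect ρ).translate (-a))
        (T4GenFunBounds.gibbsMeasure (G := G) P β) (T4GenFunBounds.gibbsMeasure (G := G) P β) ∧
      ((fun U : GaugeField P 0 G => ((U.translate a).creflect ρ).translate (-a)) ∘
          fun U : GaugeField P 0 G => ((U.translate a).creflect ρ).translate (-a)) = id ∧
      IsReflectionPositiveBdd (T4GenFunBounds.gibbsMeasure (G := G) P β) ((mPos G 0 ρ).comap (GaugeField.translate a))
        (fun U : GaugeField P 0 G => ((U.translate a).creflect ρ).translate (-a)) := by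
  obtain ⟨hm, hθm, hθ, hθθ, hRP⟩ := HistoryRPGibbs.rpPackage_gibbs_creflect (P := P) ϱ hhaar hϱ hN hre hβ ρ
  exact HistoryRPBase.rpPackage_conj (Φ := GaugeField.translate a) (Ψ := GaugeField.translate (-a)) hm hθm hθ hθθ hRP
    (T4UndoubledRP.measurable_translate a) (T4UndoubledRP.measurable_translate (-a)) (map_translate_gibbsMeasure hβ a)
    (translate_neg_translate a) (translate_translate_neg a)

/-- **THE `SU(n)` CASE, NO HYPOTHESIS ON THE GROUP LEFT.** [folklore] -/
theorem rpPackage_gibbs_cut_SU {n : ℕ} [NeZero n] (P : Params) {β : ℝ} (hβ : 0 ≤ β) (ρ : Fin P.d) (a : Site P 0) :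
    (mPos (Matrix.specialUnitaryGroup (Fin n) ℂ) 0 ρ).comap (GaugeField.translate a) ≤
        (inferInstance : MeasurableSpace (GaugeField P 0 (Matrix.specialUnitaryGroup (Fin n) ℂ))) ∧
      Measurable (fun U : GaugeField P 0 (Matrix.specialUnitaryGroup (Fin n) ℂ) =>
        ((U.translate a).creflect ρ).translate (-a)) ∧
      MeasurePreserving (fun U : GaugeField P 0 (Matrix.specialUnitaryGroup (Fin n) ℂ) =>
          ((U.translate a).creflect ρ).translate (-a))
        (T4GenFunBounds.gibbsMeasure (G := Matrix.specialUnitaryGroup (Fin n) ℂ) P β)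
        (T4GenFunBounds.gibbsMeasure (G := Matrix.specialUnitaryGroup (Fin n) ℂ) P β) ∧
      ((fun U : GaugeField P 0 (Matrix.specialUnitaryGroup (Fin n) ℂ) => ((U.translate a).creflect ρ).translate (-a)) ∘
          fun U : GaugeField P 0 (Matrix.specialUnitaryGroup (Fin n) ℂ) =>
            ((U.translate a).creflect ρ).translate (-a)) = id ∧
      IsReflectionPositiveBdd (T4GenFunBounds.gibbsMeasure (G := Matrix.specialUnitaryGroup (Fin n) ℂ) P β)
        ((mPos (Matrix.specialUnitaryGroup (Fin n) ℂ) 0 ρ).comap (GaugeField.translate a))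
        (fun U : GaugeField P 0 (Matrix.specialUnitaryGroup (Fin n) ℂ) => ((U.translate a).creflect ρ).translate (-a)) :=
  rpPackage_gibbs_cut (Literature.MathematicalPhysics.QuantumLattice.fundamentalRep (Fin n)) rfl
    (Literature.MathematicalPhysics.QuantumLattice.continuous_fundamentalRep (Fin n)) (NeZero.ne n) reTr_mul_card_SU hβ ρ a

omit [GaugeGroup G] [RegularGaugeGroup G] [HaarData G] [TopologicalSpace G] [IsTopologicalGroup G] [CompactSpace G]
  [BorelSpace G] in
/-- **THE TRANSPORTED POSITIVE σ-ALGEBRA, A USABLE CRITERION**: if every bond of `S` back-translated by `a` is a positive bond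
of the centre cut (`b.translate (−a) ∈ posBonds P 0 ρ`), then the events of the bonds of `S` are measurable for
`(mPos G 0 ρ).comap τ_a` (the coordinate `U ↦ U b` is `(U ∘ τ_a)` read at the positive bond `b − a`). [folklore] -/
theorem piFinset_le_mPos_comap_translate (ρ : Fin P.d) (a : Site P 0) {S : Finset (PBond P 0)}
    (hS : ∀ b ∈ S, b.translate (-a) ∈ posBonds P 0 ρ) :
    (Filtration.piFinset (X := fun _ : PBond P 0 => G) S : MeasurableSpace (PBond P 0 → G)) ≤
      (mPos G 0 ρ).comap (GaugeField.translate (P := P) (j := 0) (G := G) a) := by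
  have hΦm : @Measurable _ _ ((mPos G 0 ρ).comap (GaugeField.translate (P := P) (j := 0) (G := G) a)) (mPos G 0 ρ)
      (GaugeField.translate (P := P) (j := 0) (G := G) a) := measurable_iff_comap_le.2 le_rfl
  have hcoord : ∀ b' ∈ posBonds P 0 ρ, Measurable[mPos G 0 ρ] (fun W : GaugeField P 0 G => W b') := by
    intro b' hb'
    exact (measurable_pi_apply (⟨b', Finset.mem_coe.2 hb'⟩ : ↥((posBonds P 0 ρ : Finset (PBond P 0)) : Set (PBond P 0)))).comp
      (HistoryRPHalfTorus.measurable_restrict_mPos G 0 ρ)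
  rw [Filtration.piFinset_eq_comap_restrict]
  refine measurable_iff_comap_le.1
    ((@measurable_pi_iff _ _ _ ((mPos G 0 ρ).comap (GaugeField.translate (P := P) (j := 0) (G := G) a)) _ _).2 fun b => ?_)
  obtain ⟨b₀, hb₀⟩ := b
  have hread : (fun U : GaugeField P 0 G => U b₀) =
      (fun W : GaugeField P 0 G => W (b₀.translate (-a))) ∘ GaugeField.translate (P := P) (j := 0) (G := G) a := by
    funext U
    rw [Function.comp_apply, GaugeField.translate_apply, PBond.translate_translate, neg_add_cancel]
    cases b₀
    simp only [PBond.translate, add_zero]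
  show @Measurable _ _ ((mPos G 0 ρ).comap (GaugeField.translate a)) _ (fun U : GaugeField P 0 G => U b₀)
  rw [hread]
  exact (hcoord _ (hS b₀ (Finset.mem_coe.1 hb₀))).comp hΦm

end Cut

/-! ## §3 The junction with W3f at `j = 0`: one δ-averaging level of (0.4) over the Gibbs state -/

section LevelOne

variable {P : Params} {G : Type*} [GaugeGroup G] [MeasurableSpace G] [RegularGaugeGroup G] [HaarData G]
  [TopologicalSpace G] [IsTopologicalGroup G] [CompactSpace G] [BorelSpace G] {N : ℕ}
  (ϱ : G →* Matrix (Fin N) (Fin N) ℂ)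

/-- **ONE LEVEL OF (0.4) OVER THE CELL'S GIBBS STATE IS REFLECTION POSITIVE AT THE CENTRE CUT** (W3f's
`isReflectionPositiveBdd_level_blockAvg` at `j = 0`, its base binders `hθ`, `hRP` discharged by file 1's
`measurePreserving_creflect` and file 2's `rpPackage_gibbs_creflect`): for `β ≥ 0`, an axis `ρ`, `1 ≤ m + K`, a small-loop
average `ℰ` with measurable `E`, and `G` under the hypotheses of `TorusReflectionPositivity`, the δ-extended one-level state
`(gibbsMeasure P β ⊗ (δ_{posRead} × δ_{posRead ∘ c_ρ})) ⊗ δ_{crossRead}` is reflection positive for the positive fine ∕ coarse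
data and the reflection `((U, y₊, y₋), z) ↦ ((c_ρ U, y₋, y₊), crossRefl z)`. [folklore] -/
theorem isReflectionPositiveBdd_level_blockAvg_gibbs (hhaar : (HaarData.haar : Measure G) = haarProbability G)
    (hϱ : Continuous ϱ) (hN : N ≠ 0) (hre : ∀ g : G, reTr g * N = ((ϱ g).trace).re) {β : ℝ} (hβ : 0 ≤ β)
    (hK : 0 + 1 ≤ P.m + P.K) (ρ : Fin P.d) (ℰ : LoopAverage G) (hE : ∀ n, Measurable fun W : Fin (n + 1) → G => ℰ.E W) :
    IsReflectionPositiveBdd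
      (((T4GenFunBounds.gibbsMeasure (G := G) P β) ⊗ₘ
          ((Kernel.deterministic (posRead ρ (blockAvg (P := P) (j := 0) ℰ))
              (measurable_posRead ρ _ (measurable_avgFun ℰ hE))) ×ₖ
            (Kernel.deterministic (posRead ρ (blockAvg (P := P) (j := 0) ℰ))
              (measurable_posRead ρ _ (measurable_avgFun ℰ hE))).comap
              (GaugeField.creflect ρ) (measurable_creflect ρ))) ⊗ₘ
        Kernel.deterministic (crossRead ρ (blockAvg (P := P) (j := 0) ℰ))
          (measurable_crossRead ρ _ (measurable_avgFun ℰ hE)))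
      ((((mPos G 0 ρ).prod (inferInstance : MeasurableSpace (↥(posBonds P (0 + 1) ρ) → G))).comap
        (fun p : GaugeField P 0 G × ((↥(posBonds P (0 + 1) ρ) → G) × (↥(posBonds P (0 + 1) ρ) → G)) =>
          (p.1, p.2.1))).comap Prod.fst)
      (fun q : (GaugeField P 0 G × ((↥(posBonds P (0 + 1) ρ) → G) × (↥(posBonds P (0 + 1) ρ) → G))) ×
        (↥(crossBonds P (0 + 1) ρ) → G) => ((q.1.1.creflect ρ, q.1.2.swap), crossRefl ρ q.2)) := by
  haveI := T4GenFunBounds.isProbabilityMeasure_gibbsMeasure (G := G) P hβ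
  obtain ⟨-, -, hθ, -, hRP⟩ := HistoryRPGibbs.rpPackage_gibbs_creflect (P := P) ϱ hhaar hϱ hN hre hβ ρ
  exact HistoryRPAveraging.isReflectionPositiveBdd_level_blockAvg hK ρ ℰ hE hθ hRP

/-- **THE SAME FOR `SU(n)`, NO HYPOTHESIS ON THE GROUP LEFT** (left: `1 ≤ m + K`, measurability of `ℰ.E`, `β ≥ 0`). [folklore] -/
theorem isReflectionPositiveBdd_level_blockAvg_gibbs_SU {n : ℕ} [NeZero n] (P : Params) {β : ℝ} (hβ : 0 ≤ β)
    (hK : 0 + 1 ≤ P.m + P.K) (ρ : Fin P.d) (ℰ : LoopAverage (Matrix.specialUnitaryGroup (Fin n) ℂ))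
    (hE : ∀ k, Measurable fun W : Fin (k + 1) → Matrix.specialUnitaryGroup (Fin n) ℂ => ℰ.E W) :
    IsReflectionPositiveBdd
      (((T4GenFunBounds.gibbsMeasure (G := Matrix.specialUnitaryGroup (Fin n) ℂ) P β) ⊗ₘ
          ((Kernel.deterministic (posRead ρ (blockAvg (P := P) (j := 0) ℰ))
              (measurable_posRead ρ _ (measurable_avgFun ℰ hE))) ×ₖ
            (Kernel.deterministic (posRead ρ (blockAvg (P := P) (j := 0) ℰ))
              (measurable_posRead ρ _ (measurable_avgFun ℰ hE))).comap
              (GaugeField.creflect ρ) (measurable_creflect ρ))) ⊗ₘ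
        Kernel.deterministic (crossRead ρ (blockAvg (P := P) (j := 0) ℰ))
          (measurable_crossRead ρ _ (measurable_avgFun ℰ hE)))
      ((((mPos (Matrix.specialUnitaryGroup (Fin n) ℂ) 0 ρ).prod
          (inferInstance : MeasurableSpace (↥(posBonds P (0 + 1) ρ) → Matrix.specialUnitaryGroup (Fin n) ℂ))).comap
        (fun p : GaugeField P 0 (Matrix.specialUnitaryGroup (Fin n) ℂ) ×
            ((↥(posBonds P (0 + 1) ρ) → Matrix.specialUnitaryGroup (Fin n) ℂ) ×
              (↥(posBonds P (0 + 1) ρ) → Matrix.specialUnitaryGroup (Fin n) ℂ)) => (p.1, p.2.1))).comap Prod.fst)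
      (fun q : (GaugeField P 0 (Matrix.specialUnitaryGroup (Fin n) ℂ) ×
          ((↥(posBonds P (0 + 1) ρ) → Matrix.specialUnitaryGroup (Fin n) ℂ) ×
            (↥(posBonds P (0 + 1) ρ) → Matrix.specialUnitaryGroup (Fin n) ℂ))) ×
        (↥(crossBonds P (0 + 1) ρ) → Matrix.specialUnitaryGroup (Fin n) ℂ) =>
          ((q.1.1.creflect ρ, q.1.2.swap), crossRefl ρ q.2)) :=
  isReflectionPositiveBdd_level_blockAvg_gibbs (Literature.MathematicalPhysics.QuantumLattice.fundamentalRep (Fin n)) rfl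
    (Literature.MathematicalPhysics.QuantumLattice.continuous_fundamentalRep (Fin n)) (NeZero.ne n) reTr_mul_card_SU hβ hK
    ρ ℰ hE

end LevelOne

/-! ## §4 (v1.1) The `(i, k)` family at cutoff zero: W4b′'s quantifier shape, `Setup` letters

W4b′'s per-cutoff reading `HistoryChessboardEventsCutoff.CutoffReading` displays, per block hyperplane `(i, k)` of a cell
torus with `Nc` cells of `b` fine sites per direction, the five RP clauses `mP_le ∕ θ_meas ∕ θ_pres ∕ θ_invol ∕ rp` in the
shape `∀ (i : Fin d) (k : ZMod Nc), …`.  At cutoff ZERO the run's state is the Gibbs state itself; §2 at the vectors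
`a i k := (k.val·b) • e_i` gives those clauses for EVERY `b`, `Nc` (no cast `sitesPerDir 0 = Nc·b` needed: `(i, k)` merely
parametrises the translation vector), with the reflection read by the dictionary as W3e's `configReflect i (2·k·b − 1)`. -/

section Blocks

variable {P : Params} {G : Type*} [GaugeGroup G] [MeasurableSpace G] [RegularGaugeGroup G] [HaarData G]
  [TopologicalSpace G] [IsTopologicalGroup G] [CompactSpace G] [BorelSpace G] {N : ℕ}
  (ϱ : G →* Matrix (Fin N) (Fin N) ℂ)

omit [MeasurableSpace G] [RegularGaugeGroup G] [HaarData G] [TopologicalSpace G] [IsTopologicalGroup G] [CompactSpace G]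
  [BorelSpace G] in
/-- The reflection of the `(i, k)` family read through the dictionary is W3e's wall reflection
`configReflect i (2·(k·b) − 1)` (`HistoryRPBlocksWilson.rpPackage_wilson_block`'s letter, side `N·b` there). [folklore] -/
theorem toConfig_conj_creflect_block (b : ℕ) {Nc : ℕ} (i : Fin P.d) (k : ZMod Nc) (U : GaugeField P 0 G) :
    toConfig (((U.translate ((k.val * b) • (0 : Site P 0).shift i)).creflect i).translate
        (-((k.val * b) • (0 : Site P 0).shift i))) =
      configReflect i (2 * (((k.val * b : ℕ)) : ZMod (P.sitesPerDir 0)) - 1) (toConfig U) := by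
  rw [toConfig_conj_creflect, Nat.cast_mul, Nat.cast_ofNat]

/-- **THE `(i, k)` FAMILY OF LEVEL-0 RP-PACKAGES** (W4b′'s `CutoffReading` quantifier shape at cutoff zero): for `β ≥ 0`,
every block side `b` and cell count `Nc`, the five families `∀ (i : Fin d) (k : ZMod Nc)` of `mP_le ∕ θ_meas ∕ θ_pres ∕
θ_invol ∕ rp` for the Gibbs state, `mP i k := (mPos G 0 i).comap τ_{(k·b) e_i}` and
`θ i k := τ_{−(k·b) e_i} ∘ c_i ∘ τ_{(k·b) e_i}` — §2's `rpPackage_gibbs_cut` at `a := (k·b) • e_i`. [folklore] -/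
theorem rpPackage_gibbs_blocks (hhaar : (HaarData.haar : Measure G) = haarProbability G) (hϱ : Continuous ϱ) (hN : N ≠ 0)
    (hre : ∀ g : G, reTr g * N = ((ϱ g).trace).re) {β : ℝ} (hβ : 0 ≤ β) (b Nc : ℕ) :
    (∀ (i : Fin P.d) (k : ZMod Nc), (mPos G 0 i).comap (GaugeField.translate ((k.val * b) • (0 : Site P 0).shift i)) ≤
        (inferInstance : MeasurableSpace (GaugeField P 0 G))) ∧
      (∀ (i : Fin P.d) (k : ZMod Nc), Measurable (fun U : GaugeField P 0 G =>
        ((U.translate ((k.val * b) • (0 : Site P 0).shift i)).creflect i).translate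
          (-((k.val * b) • (0 : Site P 0).shift i)))) ∧
      (∀ (i : Fin P.d) (k : ZMod Nc), MeasurePreserving (fun U : GaugeField P 0 G =>
          ((U.translate ((k.val * b) • (0 : Site P 0).shift i)).creflect i).translate
            (-((k.val * b) • (0 : Site P 0).shift i)))
        (T4GenFunBounds.gibbsMeasure (G := G) P β) (T4GenFunBounds.gibbsMeasure (G := G) P β)) ∧
      (∀ (i : Fin P.d) (k : ZMod Nc), ((fun U : GaugeField P 0 G =>
          ((U.translate ((k.val * b) • (0 : Site P 0).shift i)).creflect i).translate
            (-((k.val * b) • (0 : Site P 0).shift i))) ∘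
          fun U : GaugeField P 0 G =>
            ((U.translate ((k.val * b) • (0 : Site P 0).shift i)).creflect i).translate
              (-((k.val * b) • (0 : Site P 0).shift i))) = id) ∧
      (∀ (i : Fin P.d) (k : ZMod Nc), IsReflectionPositiveBdd (T4GenFunBounds.gibbsMeasure (G := G) P β)
        ((mPos G 0 i).comap (GaugeField.translate ((k.val * b) • (0 : Site P 0).shift i)))
        (fun U : GaugeField P 0 G =>
          ((U.translate ((k.val * b) • (0 : Site P 0).shift i)).creflect i).translate
            (-((k.val * b) • (0 : Site P 0).shift i)))) :=
  ⟨fun i k => (rpPackage_gibbs_cut ϱ hhaar hϱ hN hre hβ i ((k.val * b) • (0 : Site P 0).shift i)).1,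
    fun i k => (rpPackage_gibbs_cut ϱ hhaar hϱ hN hre hβ i ((k.val * b) • (0 : Site P 0).shift i)).2.1,
    fun i k => (rpPackage_gibbs_cut ϱ hhaar hϱ hN hre hβ i ((k.val * b) • (0 : Site P 0).shift i)).2.2.1,
    fun i k => (rpPackage_gibbs_cut ϱ hhaar hϱ hN hre hβ i ((k.val * b) • (0 : Site P 0).shift i)).2.2.2.1,
    fun i k => (rpPackage_gibbs_cut ϱ hhaar hϱ hN hre hβ i ((k.val * b) • (0 : Site P 0).shift i)).2.2.2.2⟩

/-- **THE `(i, k)` FAMILY FOR `SU(n)`, NO HYPOTHESIS ON THE GROUP LEFT** (the RP member; the four structural members as in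
`rpPackage_gibbs_blocks`). [folklore] -/
theorem isReflectionPositiveBdd_gibbs_blocks_SU {n : ℕ} [NeZero n] (P : Params) {β : ℝ} (hβ : 0 ≤ β) (b Nc : ℕ)
    (i : Fin P.d) (k : ZMod Nc) :
    IsReflectionPositiveBdd (T4GenFunBounds.gibbsMeasure (G := Matrix.specialUnitaryGroup (Fin n) ℂ) P β)
      ((mPos (Matrix.specialUnitaryGroup (Fin n) ℂ) 0 i).comap
        (GaugeField.translate ((k.val * b) • (0 : Site P 0).shift i)))
      (fun U : GaugeField P 0 (Matrix.specialUnitaryGroup (Fin n) ℂ) =>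
        ((U.translate ((k.val * b) • (0 : Site P 0).shift i)).creflect i).translate
          (-((k.val * b) • (0 : Site P 0).shift i))) :=
  (rpPackage_gibbs_cut_SU P hβ i ((k.val * b) • (0 : Site P 0).shift i)).2.2.2.2

end Blocks

end

end Summit.QuantumFields.BalabanUV.T4Continuum.HistoryRPGibbsCuts
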